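import Mathlib.Analysis.Normed.Operator.Compact.Basic
import Literature.Analysis.FunctionSpaces.ContDiffHolderCompactness
import Literature.Analysis.FunctionSpaces.ContDiffHolderDiffOperator
import HarnessLib

/-!
# Compactness of support-confined operators after the inclusion `C^{k+1,r}_b → C^{k,r}_b`
# (Hölder spaces, part 27)

Topic `Literature/Analysis/FunctionSpaces`. On finite-dimensional `E`, `F` and for `0 < r ≤ 1`, a
bounded operator `L : X →L[ℝ] C^{k+1,r}_b(E, F)` all of whose values are supported in one fixed
compact set `K₀` becomes a **compact** operator after the order-reducing inclusion
`inclCLM : C^{k+1,r}_b →L[ℝ] C^{k,r}_b` of part 13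
(`ContDiffHolderFunction.isCompactOperator_inclCLM_comp`). This is the Rellich–Arzelà–Ascoli
compactness of `C^{k+1,α}(K₀) ↪ C^{k,α}(K₀)` (Gilbarg–Trudinger 2001, Lemma 6.36) in operator
form, as it is used to set up Leray–Schauder / Riesz–Fredholm arguments for zeroth-order
perturbations of elliptic parametrices.

Proof. By Arzelà–Ascoli in `C^{k+1,r}_b` (part 17, `exists_subseq_tendstoUniformly_of_norm_le`)
the image of the unit ball has, along every sequence, a subsequence all of whose derivatives of
order `≤ k + 1` converge uniformly to those of a member of `C^{k+1,r}_b`; and uniform convergence of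
the derivatives of order `≤ k + 1` implies convergence in the NORM of `C^{k,r}_b`
(`tendsto_inclCLM_of_tendstoUniformly_iteratedFDeriv`): the sup terms directly, the Hölder
seminorm of `Dᵏ` by the mean value inequality (`holderWith_of_fderiv_bound`: a differentiable map
with `‖φ‖ ≤ A`, `‖Dφ‖ ≤ D` is `r`-Hölder with constant `D + 2A`). Hence the closure of the image of
the unit ball is sequentially compact, i.e. compact. Everything is proved; no named facts.

## References

* D. Gilbarg, N. S. Trudinger, *Elliptic Partial Differential Equations of Second Order* (2001),
  Lemma 6.36. [GilbargTrudinger2001]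
-/

noncomputable section

open Set Filter Topology Function Metric
open scoped NNReal

namespace Literature.Analysis.FunctionSpaces

/-! ### Differentiable bounded maps with bounded derivative are Hölder -/

section HolderOfFDeriv

variable {E G : Type*} [NormedAddCommGroup E] [NormedSpace ℝ E] [NormedAddCommGroup G]
  [NormedSpace ℝ G] {r : ℝ≥0}

/-- A differentiable map with `‖φ‖ ≤ A` and `‖Dφ‖ ≤ D` satisfies
`‖φ z − φ z'‖ ≤ (D + 2A) ‖z − z'‖ ^ r` for `0 < r ≤ 1` (mean value inequality at distance `≤ 1`,
the crude bound `2A` beyond). [folklore] -/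
theorem norm_sub_le_mul_rpow_of_fderiv_bound (hr0 : 0 < r) (hr1 : r ≤ 1) {φ : E → G}
    (hφ : Differentiable ℝ φ) {A D : ℝ} (hA : ∀ z, ‖φ z‖ ≤ A) (hD : ∀ z, ‖fderiv ℝ φ z‖ ≤ D)
    (z z' : E) : ‖φ z - φ z'‖ ≤ (D + 2 * A) * ‖z - z'‖ ^ (r : ℝ) := by
  have hA0 : 0 ≤ A := (norm_nonneg _).trans (hA z)
  have hD0 : 0 ≤ D := (norm_nonneg _).trans (hD z)
  have hr0' : (0 : ℝ) < r := hr0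
  have hr1' : (r : ℝ) ≤ 1 := hr1
  rcases le_or_gt ‖z - z'‖ 1 with h | h
  · have hmv : ‖φ z - φ z'‖ ≤ D * ‖z - z'‖ :=
      (convex_univ).norm_image_sub_le_of_norm_fderiv_le (fun x _ => hφ x)
        (fun x _ => hD x) (mem_univ z') (mem_univ z)
    have hpow : ‖z - z'‖ ≤ ‖z - z'‖ ^ (r : ℝ) :=
      Real.self_le_rpow_of_le_one (norm_nonneg _) h hr1'
    calc ‖φ z - φ z'‖ ≤ D * ‖z - z'‖ := hmv
      _ ≤ D * ‖z - z'‖ ^ (r : ℝ) := by gcongr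
      _ ≤ (D + 2 * A) * ‖z - z'‖ ^ (r : ℝ) := by gcongr; linarith
  · have hpow : (1 : ℝ) ≤ ‖z - z'‖ ^ (r : ℝ) := Real.one_le_rpow h.le hr0'.le
    calc ‖φ z - φ z'‖ ≤ ‖φ z‖ + ‖φ z'‖ := norm_sub_le _ _
      _ ≤ 2 * A := by linarith [hA z, hA z']
      _ ≤ (D + 2 * A) * 1 := by linarith
      _ ≤ (D + 2 * A) * ‖z - z'‖ ^ (r : ℝ) := by gcongr

/-- **A differentiable map with `‖φ‖ ≤ A` and `‖Dφ‖ ≤ D` is `r`-Hölder with constant `D + 2A`**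
(`0 < r ≤ 1`). [folklore] -/
theorem holderWith_of_fderiv_bound (hr0 : 0 < r) (hr1 : r ≤ 1) {φ : E → G}
    (hφ : Differentiable ℝ φ) {A D : ℝ} (hA : ∀ z, ‖φ z‖ ≤ A) (hD : ∀ z, ‖fderiv ℝ φ z‖ ≤ D) :
    HolderWith (D + 2 * A).toNNReal r φ := by
  refine holderWith_of_dist_le fun z z' => ?_
  have hA0 : 0 ≤ A := (norm_nonneg _).trans (hA z)
  have hD0 : 0 ≤ D := (norm_nonneg _).trans (hD z)
  rw [dist_eq_norm, dist_eq_norm, Real.coe_toNNReal _ (by positivity)]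
  exact norm_sub_le_mul_rpow_of_fderiv_bound hr0 hr1 hφ hA hD z z'

end HolderOfFDeriv

namespace ContDiffHolderFunction

/-! ### Norm convergence in `C^{k,r}_b` from uniform convergence of the derivatives of order `≤ k+1` -/

section NormConvergence

variable {E F : Type*} [NormedAddCommGroup E] [NormedSpace ℝ E] [NormedAddCommGroup F]
  [NormedSpace ℝ F] {k : ℕ} {r : ℝ≥0}

/-- **Norm bound from uniform bounds**: if `‖Dʲf(x)‖ ≤ δ` for all `j ≤ k` and `Dᵏf` is `r`-Hölder
with constant `C`, then `‖f‖_{C^{k,r}} ≤ (k + 1) δ + C`. [folklore] -/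
theorem norm_le_of_iteratedFDeriv_le (f : ContDiffHolderFunction E F k r) {δ : ℝ} (hδ : 0 ≤ δ)
    (h : ∀ j ≤ k, ∀ x, ‖iteratedFDeriv ℝ j (f : E → F) x‖ ≤ δ) {C : ℝ≥0}
    (hC : HolderWith C r (iteratedFDeriv ℝ k (f : E → F))) : ‖f‖ ≤ (k + 1) * δ + C := by
  rw [norm_def]
  refine add_le_add ?_ (by exact_mod_cast hC.nnholderNorm_le)
  calc ∑ j ∈ Finset.range (k + 1), f.supNormDeriv j ≤ ∑ j ∈ Finset.range (k + 1), δ :=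
        Finset.sum_le_sum fun j hj =>
          f.supNormDeriv_le j hδ (h j (Nat.lt_succ_iff.1 (Finset.mem_range.1 hj)))
    _ = (k + 1) * δ := by
        rw [Finset.sum_const, Finset.card_range, nsmul_eq_mul, Nat.cast_succ]

variable [CompleteSpace F]

/-- **Uniform convergence of the derivatives of order `≤ k + 1` implies convergence in the norm of
`C^{k,r}_b`** (`0 < r ≤ 1`): if `Dʲfₙ → Dʲg` uniformly on `E` for every `j ≤ k + 1`
(`fₙ, g ∈ C^{k+1,r}_b`), then `fₙ → g` in `C^{k,r}_b`. The sup terms of the norm converge directly;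
the Hölder seminorm of `Dᵏ(fₙ − g)` is at most `sup ‖Dᵏ⁺¹(fₙ − g)‖ + 2 sup ‖Dᵏ(fₙ − g)‖` by the
mean value inequality. [folklore] -/
theorem tendsto_inclCLM_of_tendstoUniformly_iteratedFDeriv (hr0 : 0 < r) (hr1 : r ≤ 1)
    (f : ℕ → ContDiffHolderFunction E F (k + 1) r) (g : ContDiffHolderFunction E F (k + 1) r)
    (h : ∀ j ≤ k + 1, TendstoUniformly (fun n => iteratedFDeriv ℝ j (f n : E → F))
      (iteratedFDeriv ℝ j (g : E → F)) atTop) :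
    Tendsto (fun n => inclCLM hr1 (f n)) atTop (𝓝 (inclCLM hr1 g)) := by
  rw [tendsto_iff_norm_sub_tendsto_zero]
  refine Metric.tendsto_atTop.2 fun ε hε => ?_
  have hk5 : (0 : ℝ) < k + 5 := by positivity
  set δ : ℝ := ε / (k + 5) with hδdef
  have hδ : 0 < δ := div_pos hε hk5
  -- eventually all the differences of derivatives of order `≤ k + 1` are uniformly `≤ δ`
  have hev : ∀ᶠ n in atTop, ∀ j ≤ k + 1, ∀ x,
      ‖iteratedFDeriv ℝ j (f n : E → F) x - iteratedFDeriv ℝ j (g : E → F) x‖ ≤ δ := by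
    have hj : ∀ j ∈ Finset.range (k + 2), ∀ᶠ n in atTop, ∀ x,
        ‖iteratedFDeriv ℝ j (f n : E → F) x - iteratedFDeriv ℝ j (g : E → F) x‖ ≤ δ := by
      intro j hj
      have hjk : j ≤ k + 1 := Nat.lt_succ_iff.1 (Finset.mem_range.1 hj)
      filter_upwards [Metric.tendstoUniformly_iff.1 (h j hjk) δ hδ] with n hn x
      have hx := hn x
      rw [dist_eq_norm, norm_sub_rev] at hx
      exact hx.le
    filter_upwards [(Finset.eventually_all (Finset.range (k + 2))).2 hj] with n hn j hjk x
    exact hn j (Finset.mem_range.2 (Nat.lt_succ_of_le hjk)) x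
  obtain ⟨N, hN⟩ := eventually_atTop.1 hev
  refine ⟨N, fun n hn => ?_⟩
  rw [dist_zero_right, norm_norm]
  -- the difference, a member of `C^{k,r}_b` whose underlying function is `C^{k+1}`
  set ψ : ContDiffHolderFunction E F k r := inclCLM hr1 (f n) - inclCLM hr1 g with hψ
  have hcoe : (ψ : E → F) = (f n : E → F) - (g : E → F) := rfl
  have hDψ : ∀ j ≤ k + 1, ∀ x, iteratedFDeriv ℝ j (ψ : E → F) x =
      iteratedFDeriv ℝ j (f n : E → F) x - iteratedFDeriv ℝ j (g : E → F) x := fun j hj x => by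
    rw [hcoe]
    exact iteratedFDeriv_sub_apply ((f n).contDiff_of_le hj).contDiffAt
      (g.contDiff_of_le hj).contDiffAt
  have hb : ∀ j ≤ k + 1, ∀ x, ‖iteratedFDeriv ℝ j (ψ : E → F) x‖ ≤ δ := fun j hj x => by
    rw [hDψ j hj x]
    exact hN n hn j hj x
  -- the Hölder seminorm of `Dᵏψ` by the mean value inequality
  have hdiff : Differentiable ℝ (iteratedFDeriv ℝ k (ψ : E → F)) := by
    rw [hcoe]
    exact ((f n).contDiff.sub g.contDiff).differentiable_iteratedFDeriv
      (by exact_mod_cast Nat.lt_succ_self k)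
  have hHW : HolderWith (δ + 2 * δ).toNNReal r (iteratedFDeriv ℝ k (ψ : E → F)) :=
    holderWith_of_fderiv_bound hr0 hr1 hdiff (fun x => hb k (Nat.le_succ k) x) fun x => by
      rw [norm_fderiv_iteratedFDeriv]
      exact hb (k + 1) le_rfl x
  have hnorm := ψ.norm_le_of_iteratedFDeriv_le hδ.le
    (fun j hj x => hb j (hj.trans (Nat.le_succ k)) x) hHW
  calc ‖ψ‖ ≤ (k + 1) * δ + ((δ + 2 * δ).toNNReal : ℝ≥0) := hnorm
    _ = (k + 4) * δ := by
        rw [Real.coe_toNNReal _ (by positivity)]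
        ring
    _ < (k + 5) * δ := mul_lt_mul_of_pos_right (by linarith) hδ
    _ = ε := by
        rw [hδdef]
        field_simp

end NormConvergence

/-! ### Compactness after the inclusion -/

/-- **Rellich–Arzelà–Ascoli for Hölder spaces on a fixed compact support.** Let `E`, `F` be
finite-dimensional, `0 < r ≤ 1`, and let `L : X →L[ℝ] C^{k+1,r}_b(E, F)` be a bounded operator
all of whose values are supported in a fixed compact set `K₀`. Then `inclCLM ∘ L : X → C^{k,r}_b(E, F)`
is a compact operator: by Arzelà–Ascoli (`exists_subseq_tendstoUniformly_of_norm_le`) every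
sequence in the image of the unit ball has a subsequence all of whose derivatives of order `≤ k+1`
converge uniformly, hence (`tendsto_inclCLM_of_tendstoUniformly_iteratedFDeriv`) a subsequence
converging in `C^{k,r}_b`; so the closure of that image is sequentially compact, i.e. compact
(Gilbarg–Trudinger 2001, Lemma 6.36: bounded sets of `C^{k+1,α}` on a compact set are precompact
in `C^{k,α}`). [cite: GilbargTrudinger2001, Lemma 6.36] -/
theorem isCompactOperator_inclCLM_comp {E F : Type} [NormedAddCommGroup E] [NormedSpace ℝ E]
    [FiniteDimensional ℝ E] [NormedAddCommGroup F] [NormedSpace ℝ F] [FiniteDimensional ℝ F]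
    {k : ℕ} {r : ℝ≥0} (hr0 : 0 < r) (hr1 : r ≤ 1)
    {X : Type*} [NormedAddCommGroup X] [NormedSpace ℝ X]
    (L : X →L[ℝ] ContDiffHolderFunction E F (k + 1) r) {K₀ : Set E} (hK₀ : IsCompact K₀)
    (hL : ∀ x, tsupport (L x : E → F) ⊆ K₀) :
    IsCompactOperator ((ContDiffHolderFunction.inclCLM hr1).comp L) := by
  set S : Set (ContDiffHolderFunction E F k r) :=
    ((ContDiffHolderFunction.inclCLM hr1).comp L) '' closedBall 0 1 with hS
  -- every sequence in `S` has a subsequence converging in `C^{k,r}_b`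
  have hseq : ∀ s : ℕ → ContDiffHolderFunction E F k r, (∀ n, s n ∈ S) →
      ∃ a, ∃ φ : ℕ → ℕ, StrictMono φ ∧ Tendsto (s ∘ φ) atTop (𝓝 a) := by
    intro s hs
    choose g hg hsg using hs
    have hB : ∀ n, ‖L (g n)‖ ≤ ‖L‖ := fun n => by
      calc ‖L (g n)‖ ≤ ‖L‖ * ‖g n‖ := L.le_opNorm _
        _ ≤ ‖L‖ * 1 := by gcongr; simpa using hg n
        _ = ‖L‖ := mul_one _
    obtain ⟨φ, hφ, G, -, hG⟩ :=
      exists_subseq_tendstoUniformly_of_norm_le hr0 hK₀ (fun n => L (g n)) hB (fun n => hL _)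
    refine ⟨inclCLM hr1 G, φ, hφ, ?_⟩
    have hlim := tendsto_inclCLM_of_tendstoUniformly_iteratedFDeriv hr0 hr1
      (fun n => L (g (φ n))) G hG
    have hsφ : (s ∘ φ) = fun n => inclCLM hr1 (L (g (φ n))) := by
      funext n
      simp only [Function.comp_apply, ← hsg (φ n), ContinuousLinearMap.comp_apply]
    rw [hsφ]
    exact hlim
  -- the closure of `S` is sequentially compact, hence compact
  have hcl : IsCompact (closure S) := by
    rw [isCompact_iff_isSeqCompact]
    intro x hx
    -- approximate each `x n ∈ closure S` by `s n ∈ S` within `1/(n+1)`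
    have hex : ∀ n, ∃ y ∈ S, dist (x n) y < 1 / ((n : ℝ) + 1) := fun n =>
      Metric.mem_closure_iff.1 (hx n) _ (by positivity)
    choose s hsS hds using hex
    obtain ⟨a, φ, hφ, ha⟩ := hseq s hsS
    refine ⟨a, ?_, φ, hφ, ?_⟩
    · exact mem_closure_of_tendsto ha (Eventually.of_forall fun n => hsS (φ n))
    · -- `x ∘ φ` is asymptotic to `s ∘ φ`
      have hd : Tendsto (fun n => dist ((x ∘ φ) n) ((s ∘ φ) n)) atTop (𝓝 0) := by
        have h1n : Tendsto (fun n : ℕ => 1 / ((φ n : ℝ) + 1)) atTop (𝓝 0) :=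
          (tendsto_one_div_add_atTop_nhds_zero_nat (𝕜 := ℝ)).comp hφ.tendsto_atTop
        exact squeeze_zero (fun n => dist_nonneg) (fun n => (hds (φ n)).le) h1n
      exact (tendsto_iff_of_dist hd).2 ha
  rw [isCompactOperator_iff_exists_mem_nhds_image_subset_compact]
  exact ⟨closedBall 0 1, Metric.closedBall_mem_nhds _ one_pos, closure S, hcl, subset_closure⟩

end ContDiffHolderFunction

end Literature.Analysis.FunctionSpaces

end
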